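import Summits.ResolutionOfSingularities.ResolutionOfSingularities.Theorems.PurelyInseparableDim4AtlasNodeStep
import Summits.ResolutionOfSingularities.ResolutionOfSingularities.Theorems.PurelyInseparableDim4JointHereditaryNodes
import Summits.ResolutionOfSingularities.ResolutionOfSingularities.Theorems.PurelyInseparableDim4JointHereditaryRoot
import HarnessLib

/-!
# Purely inseparable four-folds: the NODE THEOREM for atlas members and the ROOT of the atlas forest — a marked resolution of `z^p + F`
# from a v4 plan at one root host (brick S3 (c) v4, tranche 1, brick A5 + A5-root; cell `res-dim4-pi`)

[OURS · counted 0] (D-0157 DOOR 2; host item stmt-ResolutionOfSingularities-16155, helper). Nothing here proves resolution of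
singularities in dimension ≥ 4 / characteristic `p`. (`res-dim4-typ-3/S3c-V4-ATLAS-MEMBERS-DESIGN.md` §2 A5.)

NODE THEOREM (65's `exists_isMarkedResolution_of_joint_forest_hereditary` for ATLAS MEMBERS): a node `(X′, M′)` over `(X₀, M₀)` carries
point members with `PointData` and pairwise disjoint closed atlas members each with `MemberDataAT` (DefsThree) for its reading set; every
closed order-`p` point is a point member or on a member. Blow up any atlas member (A4 `atlas_node_step`) and recurse; with no atlas member
left the point forest (part 13) finishes. TERMINATION: `CutExpand` on the multiset of the members' READING SETS for the relation «`R′`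
non-empty and all its readings `AEdge`-successors of one reading of `R`» — accessible because every reading is `AEdge`-accessible
(`acc_readingSet_of_forall_acc`).

ROOT (66's `exists_isMarkedResolution_hereditary_root_hosts` for the v4 plan format with ONE root host): `F` clean, `≠ 0`; the root member
`V(z − g, x_S − b_S)` of `z^p + F` in `𝔸⁵` (typ-3 g2's `root_member_package`) carries `MemberDataAT` with the single reading
`(⟨deletePthPowers(τ_b F), 0, ∅⟩, S, ∅, ∅)` as soon as `BlockA` holds along `AEdge` from it and the reading is `AEdge`-accessible; if every
closed point of order `≥ p` lies on it, the node theorem yields a marked resolution.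

* `acc_readingSet_of_forall_acc`, **`exists_isMarkedResolution_of_atlas_forest`**, **`exists_isMarkedResolution_of_atlas_node`** (σ = 𝟙),
  `root_memberDataAT`, **`exists_isMarkedResolution_atlas_root`**.

AI-produced formalisation, weaker than expert review. bears_on: LADDER-RESOLUTION:D157-DOOR2 (res-dim4-pi · S3 (c) v4 A5 / A5-root).
-/

set_option linter.dupNamespace false -- D-0017: single-problem summit path `Summit.<S>.<S>.…` by design

noncomputable section

open MvPolynomial Finset CategoryTheory AlgebraicGeometry Opposite TopologicalSpace
open AlgebraicGeometry.Scheme.IdealSheafData (ofIdealTop vanishingIdeal)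

namespace Summit.ResolutionOfSingularities.ResolutionOfSingularities.Theorems.PIDim4

open Literature.AlgebraicGeometry.Resolution
open Literature.AlgebraicGeometry.Resolution.Hauser2010
open Literature.AlgebraicGeometry.Resolution.AffinePointBlowup (P A γ coord Wtop ξ)

namespace Equimultiple

section NodesAT

variable {K : Type} [Field K] {p : ℕ} [hp : Fact p.Prime] [CharP K p]

omit hp [CharP K p] in
/-- **Reading sets of accessible readings are accessible** for the relation «`R′` non-empty, all its readings `AEdge`-successors of one
reading of `R`, `R′ ≠ R`». [folklore] -/
theorem acc_readingSet_of_forall_acc [DecidableEq K] (plan : AReading K → Finset (Fin 4 × (Fin 4 → K) × Finset (Fin 4)))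
    (R : Finset (AReading K)) (h : ∀ r ∈ R, Acc (fun q' q : AReading K => AEdge p plan q' q) r) :
    Acc (fun R' R : Finset (AReading K) => (R'.Nonempty ∧ ∃ r ∈ R, ∀ r' ∈ R', AEdge p plan r' r) ∧ R' ≠ R) R := by
  have key : ∀ r : AReading K, Acc (fun q' q : AReading K => AEdge p plan q' q) r → ∀ R' : Finset (AReading K),
      (∀ r' ∈ R', AEdge p plan r' r) →
      Acc (fun R' R : Finset (AReading K) => (R'.Nonempty ∧ ∃ r ∈ R, ∀ r' ∈ R', AEdge p plan r' r) ∧ R' ≠ R) R' := by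
    intro r hr
    induction hr with
    | intro r _ ih =>
      intro R' hR'
      refine Acc.intro R' fun R'' hR'' => ?_
      obtain ⟨⟨-, r₁, hr₁, hall⟩, -⟩ := hR''
      exact ih r₁ (hR' r₁ hr₁) R'' hall
  refine Acc.intro R fun R' hR' => ?_
  obtain ⟨⟨-, r, hr, hall⟩, -⟩ := hR'
  exact key r (h r hr) R' hall

variable [DecidableEq K]

/-- **THE NODE THEOREM FOR ATLAS MEMBERS (A5).** See the module docstring. [cite: BierstoneGrigorievMilmanWlodarczyk2011, Def. 3.1.3;
§4 Step 2b] [cite: Hauser2010, §§F–G] -/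
theorem exists_isMarkedResolution_of_atlas_forest {X₀ : Scheme.{0}} [IsLocallyNoetherian X₀] [JacobsonSpace X₀]
    [IsAlgClosed K] [DecidableEq (AReading K)] (M₀ : MarkedIdeal X₀) (hE : HasSNC M₀.boundary) (hmult : M₀.mult = p)
    (plan : AReading K → Finset (Fin 4 × (Fin 4 → K) × Finset (Fin 4)))
    (leaves : AReading K → Finset (Fin 4 × (Fin 4 → K)))
    (T : Multiset (Finset (AReading K)))
    (hT : Acc (Relation.CutExpand (fun R' R : Finset (AReading K) =>
      (R'.Nonempty ∧ ∃ r ∈ R, ∀ r' ∈ R', AEdge p plan r' r) ∧ R' ≠ R)) T) :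
    ∀ (X' : Scheme.{0}) (σ : X' ⟶ X₀) (M' : MarkedIdeal X') (_ : IsMultipleBlowup M₀ σ M')
      (pts : Finset X') (st : X' → State K) (_ : ∀ x ∈ pts, IsClosed ({x} : Set X'))
      (_ : ∀ x ∈ pts, PointData p M' x (st x))
      (cms : Finset (Closeds X')) (Rd : Closeds X' → Finset (AReading K))
      (_ : ∑ c ∈ cms, ({Rd c} : Multiset (Finset (AReading K))) = T)
      (_ : ∀ c ∈ cms, MemberDataAT p plan leaves M' c (Rd c))
      (_ : ∀ c ∈ cms, ∀ c' ∈ cms, c ≠ c' → Disjoint (c : Set X') (c' : Set X'))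
      (_ : ∀ x ∈ pts, ∀ c ∈ cms, x ∉ (c : Set X'))
      (_ : ∀ z : X', IsClosed ({z} : Set X') → (p : ℕ∞) ≤ idealOrder M'.ideal z → z ∈ pts ∨ ∃ c ∈ cms, z ∈ (c : Set X')),
      ∃ (X'' : Scheme.{0}) (ρ : X'' ⟶ X₀) (M'' : MarkedIdeal X''), IsMarkedResolution M₀ ρ M'' := by
  classical
  induction hT with
  | intro T _ ih =>
  intro X' σ M' hσ pts st hclosed hdata cms Rd hTeq hcdata hdisj₁ hdisj₂ hcover
  haveI : IsLocallyNoetherian X' := hσ.isLocallyNoetherian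
  haveI : JacobsonSpace X' := jacobsonSpace_of_isMultipleBlowup hσ
  have hmult' : M'.mult = p := hσ.mult_eq.trans hmult
  rcases cms.eq_empty_or_nonempty with hcms | ⟨c₁, hc₁⟩
  · -- no atlas member: the point forest
    haveI : Std.Irrefl (fun s' s : State K => Edge p Finset.univ s s' ∧ s' ≠ s) := ⟨fun s hs => hs.2 rfl⟩
    have hTp : Acc (Relation.CutExpand (fun s' s : State K => Edge p Finset.univ s s' ∧ s' ≠ s))
        (pts.val.map st) := by
      refine Relation.acc_of_singleton fun s hs => ?_
      rw [Multiset.mem_map] at hs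
      obtain ⟨x, hx, rfl⟩ := hs
      exact (Subrelation.accessible (fun hs => hs.1) (hdata x (Finset.mem_val.mp hx)).2.2.2.1).cutExpand
    refine exists_isMarkedResolution_of_config_local M₀ hE hmult _ hTp X' σ M' hσ pts st rfl hclosed
      (fun z hz hzo => ?_) hdata
    rcases hcover z hz hzo with h | ⟨c, hc, -⟩
    · exact h
    · rw [hcms] at hc; exact absurd hc (Finset.notMem_empty c)
  -- blow up the atlas member `c₁`
  have hcd₁ := hcdata c₁ hc₁
  obtain ⟨hbasic₁, -, hreg₁, hsnc₁, hatlas₁, hblocks₁, hacc₁⟩ := hcd₁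
  set Ce : X'.IdealSheafData := vanishingIdeal c₁ with hCe
  have hπ : IsBlowup (blowup.π Ce) Ce := blowup.isBlowup Ce
  have hCsupp : ∀ z : X', z ∉ (Ce.support : Set X') ↔ z ∉ (c₁ : Set X') := fun z => by
    rw [hCe, Scheme.IdealSheafData.coe_support_vanishingIdeal]
  have hsub₁ : (c₁ : Set X') ⊆ M'.support :=
    coe_member_subset_support_of_atlasZF M' hmult' c₁ (Rd c₁) hatlas₁ fun r hr => (hbasic₁ r hr).2.2.2
  have h₁ : IsMultipleBlowup M₀ (blowup.π Ce ≫ σ) (M'.transform (blowup.π Ce) Ce) :=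
    IsMultipleBlowup.blowup hσ Ce (blowup.π Ce) hπ hreg₁
      (by rw [hCe, Scheme.IdealSheafData.coe_support_vanishingIdeal]; exact hsub₁) hsnc₁
  haveI : IsLocallyNoetherian (blowup Ce) := h₁.isLocallyNoetherian
  set M'' := M'.transform (blowup.π Ce) Ce with hM''
  have hM''I : M''.ideal = controlledTransform (blowup.π Ce) Ce M'.ideal M'.mult := rfl
  -- the members side of the step (A4)
  obtain ⟨cms', Rd', hcdata', hdisj₁', ⟨KR, hKR, hTid⟩, hsit, hcov, hscov, hfin⟩ :=
    atlas_node_step M' hmult' plan leaves cms Rd hcdata hdisj₁ hc₁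
  -- leaf points: closed order-`p` points over `c₁` outside all new members
  set ov : Finset (blowup Ce) := hfin.toFinset with hov_def
  have hmem_over : ∀ w, w ∈ ov ↔ IsClosed ({w} : Set (blowup Ce)) ∧ blowup.π Ce w ∈ (c₁ : Set X') ∧
      (p : ℕ∞) ≤ idealOrder M''.ideal w ∧ ∀ d ∈ cms', w ∉ (d : Set (blowup Ce)) := fun w => by
    rw [hov_def, Set.Finite.mem_toFinset, Set.mem_setOf_eq]
  have hleaf : ∀ w : blowup Ce, IsClosed ({w} : Set (blowup Ce)) → blowup.π Ce w ∈ (c₁ : Set X') →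
      (p : ℕ∞) ≤ idealOrder M''.ideal w → (∀ d ∈ cms', w ∉ (d : Set (blowup Ce))) →
      ∃ r ∈ Rd c₁, ∃ l ∈ leaves r, l.1 ∈ r.2.1 ∧ l.2 l.1 = 0 ∧ CentreBlowup.IsEquimultiplePoint p r.2.1 l.1 l.2 r.1 ∧
        ∃ (Y' : Scheme.{0}) (φ' : Y' ⟶ blowup Ce) (ψ' : Y' ⟶ P 4 K) (_ : IsOpenImmersion φ') (_ : IsOpenImmersion ψ')
          (y' : Y'), φ' y' = w ∧ ψ' y' = ξ 4 K ∧
          M''.ideal.comap φ' = (hypSheaf p (CentreBlowup.step p r.2.1 l.1 l.2 r.1).F).comap ψ' := fun w hw hwc hord hout => by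
    rcases hcov w hw hwc hord with ⟨d, hd, hwd⟩ | h
    · exact absurd hwd (hout d hd)
    · exact h
  -- point survivors
  have hpre : ∀ z : {z // z ∈ pts}, ∃ w : blowup Ce, blowup.π Ce w = z.1 := fun z =>
    exists_eq_of_not_mem_support hπ ((hCsupp z.1).mpr (hdisj₂ z.1 z.2 c₁ hc₁))
  set pre : {z // z ∈ pts} → blowup Ce := fun z => (hpre z).choose with hpre_def
  have hπpre : ∀ z : {z // z ∈ pts}, blowup.π Ce (pre z) = z.1 := fun z => (hpre z).choose_spec
  set surv : Finset (blowup Ce) := pts.attach.image pre with hsurv_def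
  have hmem_surv : ∀ w, w ∈ surv ↔ blowup.π Ce w ∈ pts := by
    intro w
    rw [hsurv_def, Finset.mem_image]
    refine ⟨by rintro ⟨z, -, rfl⟩; rw [hπpre z]; exact z.2, fun hw => ⟨⟨blowup.π Ce w, hw⟩, Finset.mem_attach _ _,
      eq_of_eq_of_not_mem_support hπ (hπpre _) (by rw [hπpre]; exact (hCsupp _).mpr (hdisj₂ _ hw c₁ hc₁))⟩⟩
  have hdisj_os : Disjoint ov surv := Finset.disjoint_left.mpr fun ⦃w⦄ hw hw' =>
    hdisj₂ _ ((hmem_surv w).mp hw') c₁ hc₁ ((hmem_over w).mp hw).2.1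
  set pts' : Finset (blowup Ce) := ov.disjUnion surv hdisj_os with hpts'
  have hmem' : ∀ w, w ∈ pts' ↔ w ∈ ov ∨ w ∈ surv := fun w => Finset.mem_disjUnion
  have hsurv_ord : ∀ w : blowup Ce, blowup.π Ce w ∉ (c₁ : Set X') →
      idealOrder M''.ideal w = idealOrder M'.ideal (blowup.π Ce w) := fun w hwx =>
    idealOrder_controlledTransform_eq_of_eq_of_not_mem_support hπ ((hCsupp _).mpr hwx) M'.ideal M'.mult rfl
  set st' : blowup Ce → State K := fun w =>
    if hc : IsClosed ({w} : Set (blowup Ce)) ∧ blowup.π Ce w ∈ (c₁ : Set X') ∧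
        (p : ℕ∞) ≤ idealOrder M''.ideal w ∧ ∀ d ∈ cms', w ∉ (d : Set (blowup Ce)) then
      CentreBlowup.step p (hleaf w hc.1 hc.2.1 hc.2.2.1 hc.2.2.2).choose.2.1
        (hleaf w hc.1 hc.2.1 hc.2.2.1 hc.2.2.2).choose_spec.2.choose.1
        (hleaf w hc.1 hc.2.1 hc.2.2.1 hc.2.2.2).choose_spec.2.choose.2
        (hleaf w hc.1 hc.2.1 hc.2.2.1 hc.2.2.2).choose.1
    else st (blowup.π Ce w) with hst'
  have hover : ∀ w ∈ ov, ∃ r ∈ Rd c₁, ∃ l ∈ leaves r, st' w = CentreBlowup.step p r.2.1 l.1 l.2 r.1 ∧ l.1 ∈ r.2.1 ∧ l.2 l.1 = 0 ∧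
      CentreBlowup.IsEquimultiplePoint p r.2.1 l.1 l.2 r.1 ∧
      ∃ (Y' : Scheme.{0}) (φ' : Y' ⟶ blowup Ce) (ψ' : Y' ⟶ P 4 K) (_ : IsOpenImmersion φ') (_ : IsOpenImmersion ψ')
        (y' : Y'), φ' y' = w ∧ ψ' y' = ξ 4 K ∧
        M''.ideal.comap φ' = (hypSheaf p (CentreBlowup.step p r.2.1 l.1 l.2 r.1).F).comap ψ' := by
    intro w hw
    have hc := (hmem_over w).mp hw
    obtain ⟨hr, hrest⟩ := (hleaf w hc.1 hc.2.1 hc.2.2.1 hc.2.2.2).choose_spec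
    obtain ⟨hl, hrest'⟩ := hrest.choose_spec
    exact ⟨_, hr, _, hl, by rw [hst']; exact dif_pos hc, hrest'⟩
  have hoff : ∀ w : blowup Ce, blowup.π Ce w ∉ (c₁ : Set X') → st' w = st (blowup.π Ce w) := fun w hwx => by
    rw [hst']; exact dif_neg fun hc => hwx hc.2.1
  -- the multiset of reading sets decreases
  have hcut : Relation.CutExpand (fun R' R : Finset (AReading K) =>
      (R'.Nonempty ∧ ∃ r ∈ R, ∀ r' ∈ R', AEdge p plan r' r) ∧ R' ≠ R)
      (∑ d ∈ cms', ({Rd' d} : Multiset (Finset (AReading K)))) T := by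
    refine ⟨KR, Rd c₁, fun R' hR' => ?_, ?_⟩
    · obtain ⟨hne, r, hr, hall⟩ := hKR R' hR'
      refine ⟨⟨hne, r, hr, hall⟩, fun heq => ?_⟩
      subst heq
      exact not_rel_self_of_acc (hacc₁ r hr) (hall r hr)
    · rw [← hTeq]
      exact hTid
  -- recurse on the new stage
  refine ih _ hcut (blowup Ce) (blowup.π Ce ≫ σ) M'' h₁ pts' st' (fun w hw => ?_) (fun w hw => ?_) cms' Rd'
    rfl hcdata' hdisj₁' (fun w hw d hd => ?_) (fun z hz hzo => ?_)
  · -- closedness of the point members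
    rcases (hmem' w).mp hw with hw | hw
    · exact ((hmem_over w).mp hw).1
    · have hz := (hmem_surv w).mp hw
      exact isClosed_singleton_of_not_mem_support hπ (hclosed _ hz) ((hCsupp _).mpr (hdisj₂ _ hz c₁ hc₁))
  · -- data of the point members
    rcases (hmem' w).mp hw with hw | hw
    · obtain ⟨r, hr, l, hl, hst'w, hl1, hl2, heq, Y', φ', ψ', _, _, y', hφ', hψ', hMw⟩ := hover w hw
      obtain ⟨hFr, hcleanr, hSr⟩ := hbasic₁ r hr
      have hP3 := (hblocks₁ r hr r Relation.ReflTransGen.refl).2.2.1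
      obtain ⟨-, hP3l⟩ := hP3 l hl
      obtain ⟨haccl, hfinl⟩ := hP3l heq
      rw [hst'w]
      refine ⟨step_F_ne_zero_of_isClean hl1 l.2 r.1 hFr hcleanr hSr.2, isClean_step r.2.1 l.1 l.2 r.1,
        ordAlong_univ_step_of_isEquimultiplePoint' r.2.1 l.1 l.2 r.1 heq, haccl, fun s' hs' => ?_, Y', φ', ψ',
        inferInstance, inferInstance, y', hφ', hψ', hMw⟩
      exact finite_closedOver_model_of_finite_pairs s'
        (ordAlong_univ_of_reflTransGen_edge (ordAlong_univ_step_of_isEquimultiplePoint' r.2.1 l.1 l.2 r.1 heq) hs')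
        (hfinl s' hs')
    · have hz := (hmem_surv w).mp hw
      obtain ⟨hFz, hcleanz, hpermz, haccz, hlocfinz, Yz, φz, ψz, _, _, yz, hφz, hψz, hMz⟩ := hdata _ hz
      have hnot : blowup.π Ce w ∉ (Ce.support : Set X') := (hCsupp _).mpr (hdisj₂ _ hz c₁ hc₁)
      obtain ⟨Y', φ', ψ', _, _, y', hφ', hψ', hMw⟩ :=
        exists_zigzag_comap_controlledTransform_of_not_mem_support hπ hnot φz ψz yz hφz hψz M'.ideal
          (hypSheaf p (st (blowup.π Ce w)).F) hMz M'.mult (w := w) rfl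
      rw [hoff w (hdisj₂ _ hz c₁ hc₁)]
      exact ⟨hFz, hcleanz, hpermz, haccz, hlocfinz, Y', φ', ψ', inferInstance, inferInstance, y', hφ', hψ',
        by rw [hM''I]; exact hMw⟩
  · -- point members avoid atlas members
    rcases (hmem' w).mp hw with hw | hw
    · exact ((hmem_over w).mp hw).2.2.2 d hd
    · intro hwd
      have hz := (hmem_surv w).mp hw
      rcases hsit d hd w hwd with h | ⟨c, hc, -, h⟩
      · exact hdisj₂ _ hz c₁ hc₁ h
      · exact hdisj₂ _ hz c hc h
  · -- every closed order-`p` point of the new stage is a point member or on a member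
    by_cases hzx : blowup.π Ce z ∈ (c₁ : Set X')
    · by_cases hk : ∃ d ∈ cms', z ∈ (d : Set (blowup Ce))
      · exact Or.inr hk
      · push Not at hk
        exact Or.inl ((hmem' z).mpr (Or.inl ((hmem_over z).mpr ⟨hz, hzx, hzo, hk⟩)))
    · have hzo' : (p : ℕ∞) ≤ idealOrder M'.ideal (blowup.π Ce z) := by rw [← hsurv_ord z hzx]; exact hzo
      rcases hcover _ (isClosed_singleton_π' hπ hz) hzo' with h | ⟨c, hc, hzc⟩
      · exact Or.inl ((hmem' z).mpr (Or.inr ((hmem_surv z).mpr h)))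
      · have hcc : c ≠ c₁ := fun h => hzx (by rw [← h]; exact hzc)
        exact Or.inr (hscov z c hc hcc hzc)

/-- **COROLLARY: an atlas node that is its own root.** The node theorem started at `σ = 𝟙`; the `CutExpand` accessibility of the initial
multiset of reading sets comes from the members' `Acc` data. [cite: BierstoneGrigorievMilmanWlodarczyk2011, Def. 3.1.3] -/
theorem exists_isMarkedResolution_of_atlas_node {X₀ : Scheme.{0}} [IsLocallyNoetherian X₀] [JacobsonSpace X₀]
    [IsAlgClosed K] [DecidableEq (AReading K)] (M₀ : MarkedIdeal X₀) (hE : HasSNC M₀.boundary) (hmult : M₀.mult = p)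
    (plan : AReading K → Finset (Fin 4 × (Fin 4 → K) × Finset (Fin 4)))
    (leaves : AReading K → Finset (Fin 4 × (Fin 4 → K)))
    (pts : Finset X₀) (st : X₀ → State K) (hclosed : ∀ x ∈ pts, IsClosed ({x} : Set X₀))
    (hdata : ∀ x ∈ pts, PointData p M₀ x (st x))
    (cms : Finset (Closeds X₀)) (Rd : Closeds X₀ → Finset (AReading K))
    (hcdata : ∀ c ∈ cms, MemberDataAT p plan leaves M₀ c (Rd c))
    (hdisj₁ : ∀ c ∈ cms, ∀ c' ∈ cms, c ≠ c' → Disjoint (c : Set X₀) (c' : Set X₀))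
    (hdisj₂ : ∀ x ∈ pts, ∀ c ∈ cms, x ∉ (c : Set X₀))
    (hcover : ∀ z : X₀, IsClosed ({z} : Set X₀) → (p : ℕ∞) ≤ idealOrder M₀.ideal z → z ∈ pts ∨ ∃ c ∈ cms, z ∈ (c : Set X₀)) :
    ∃ (X'' : Scheme.{0}) (ρ : X'' ⟶ X₀) (M'' : MarkedIdeal X''), IsMarkedResolution M₀ ρ M'' := by
  classical
  haveI : Std.Irrefl (fun R' R : Finset (AReading K) => (R'.Nonempty ∧ ∃ r ∈ R, ∀ r' ∈ R', AEdge p plan r' r) ∧ R' ≠ R) :=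
    ⟨fun R hR => hR.2 rfl⟩
  have hT : Acc (Relation.CutExpand (fun R' R : Finset (AReading K) =>
      (R'.Nonempty ∧ ∃ r ∈ R, ∀ r' ∈ R', AEdge p plan r' r) ∧ R' ≠ R))
      (∑ c ∈ cms, ({Rd c} : Multiset (Finset (AReading K)))) := by
    refine Relation.acc_of_singleton fun R hR => ?_
    obtain ⟨c, hc, hR⟩ := Multiset.mem_sum.mp hR
    rw [Multiset.mem_singleton] at hR
    subst hR
    exact (acc_readingSet_of_forall_acc plan (Rd c) (hcdata c hc).2.2.2.2.2.2).cutExpand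
  exact exists_isMarkedResolution_of_atlas_forest M₀ hE hmult plan leaves _ hT X₀ (𝟙 X₀) M₀ (IsMultipleBlowup.refl M₀)
    pts st hclosed hdata cms Rd rfl hcdata hdisj₁ hdisj₂ hcover

end NodesAT

section RootAT

variable {K : Type} [Field K] {p : ℕ} [hp : Fact p.Prime] [CharP K p] [DecidableEq K]

/-- **The root host as an atlas member with one reading.** [cite: BierstoneGrigorievMilmanWlodarczyk2011, Def. 3.1.3] -/
theorem root_memberDataAT [IsAlgClosed K] [DecidableEq (AReading K)] (F : MvPolynomial (Fin 4) K) (hF : F ≠ 0)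
    (hclean : Literature.Barriers.ResolutionOfSingularities.HauserPerlega.IsClean p F)
    (plan : AReading K → Finset (Fin 4 × (Fin 4 → K) × Finset (Fin 4)))
    (leaves : AReading K → Finset (Fin 4 × (Fin 4 → K))) (b : Fin 4 → K) (S : Finset (Fin 4)) (s : State K)
    (hs : s = ⟨deletePthPowers p (PointBlowup.translate b F), 0, ∅⟩) (hS : IsPermissibleCentre p S s.F)
    (hblocks : ∀ q : AReading K, Relation.ReflTransGen (fun a e : AReading K => AEdge p plan e a)
      (s, S, (∅ : Finset (Fin 4 × K)), (∅ : Finset (Fin 4))) q → BlockA p plan leaves q)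
    (hacc : Acc (fun q' q : AReading K => AEdge p plan q' q) (s, S, (∅ : Finset (Fin 4 × K)), (∅ : Finset (Fin 4)))) :
    ∃ c₀ : Closeds (P 4 K),
      MemberDataAT p plan leaves (⟨hypSheaf p F, [], p⟩ : MarkedIdeal (P 4 K)) c₀
        ({(s, S, (∅ : Finset (Fin 4 × K)), (∅ : Finset (Fin 4)))} : Finset (AReading K)) ∧
      (∀ z : P 4 K, z ∈ (c₀ : Set (P 4 K)) → ∀ i ∈ S, (X i.succ - C (b i) : A 4 K) ∈ z.asIdeal) ∧
      (∀ z : P 4 K, IsClosed ({z} : Set (P 4 K)) → (1 : ℕ∞) ≤ idealOrder (hypSheaf p F) z →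
        (∀ i ∈ S, (X i.succ - C (b i) : A 4 K) ∈ z.asIdeal) → z ∈ (c₀ : Set (P 4 K))) := by
  classical
  have hS' : IsPermissibleCentre p S (deletePthPowers p (PointBlowup.translate b F)) := by rw [hs] at hS; exact hS
  obtain ⟨c₀, hreg, hsnc, ⟨Y, φ, ψ, hφ, hψ, hM, hZ, hcφ, hsee⟩, hin, hall⟩ := root_member_package (p := p) F b hS'
  have hF₀ : s.F ≠ 0 := by rw [hs]; exact deletePthPowers_translate_ne_zero hF hclean b
  have hclean₀ : Literature.Barriers.ResolutionOfSingularities.HauserPerlega.IsClean p s.F := by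
    rw [hs]; exact isClean_deletePthPowers _
  have hM' : (⟨hypSheaf p F, [], p⟩ : MarkedIdeal (P 4 K)).ideal.comap φ = (hypSheaf p s.F).comap ψ := by rw [hs]; exact hM
  have himg := coe_member_eq_image φ ψ c₀ hZ hcφ
  have hr : ∀ r : ↥({(s, S, (∅ : Finset (Fin 4 × K)), (∅ : Finset (Fin 4)))} : Finset (AReading K)),
      (r : AReading K) = (s, S, (∅ : Finset (Fin 4 × K)), (∅ : Finset (Fin 4))) := fun r => Finset.mem_singleton.mp r.2
  have hown : ∀ v : Fin 4 → K, ownedSetZ S ((∅ : Finset (Fin 4)).image fun m => (m, v m)) =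
      (AffineCoordBlowup.CΛ 4 K (insert 0 (Fin.succ '' (S : Set (Fin 4)))) : Set (P 4 K)) := fun v => by
    rw [Finset.image_empty]; exact ownedSetZ_empty S
  refine ⟨c₀, ⟨fun r hr' => ?_, fun r hr' => ?_, hreg, hsnc, ⟨fun _ => Y, fun _ => φ, fun _ => ψ, fun r => ?_, ?_, ?_⟩,
    fun r hr' q hq => ?_, fun r hr' => ?_⟩, hin, hall⟩
  · rw [Finset.mem_singleton.mp hr']; exact ⟨hF₀, hclean₀, hS⟩
  · rw [Finset.mem_singleton.mp hr']
    exact ⟨fun iv hiv => absurd hiv (Finset.notMem_empty iv), fun m hm => absurd hm (Finset.notMem_empty m)⟩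
  · rw [hr r]
    refine ⟨hφ, hψ, hM', hZ, hsee, fun v => ?_, fun _ => 0, fun _ => 0, fun D hD => absurd hD List.not_mem_nil,
      fun D₁ hD₁ => absurd hD₁ List.not_mem_nil⟩
    change IsClosed (φ '' (ψ ⁻¹' ownedSetZ S ((∅ : Finset (Fin 4)).image fun m => (m, v m))))
    rw [hown v, himg]
    exact c₀.isClosed
  · intro x hx
    refine Set.mem_iUnion.mpr ⟨⟨_, Finset.mem_singleton_self _⟩, ?_⟩
    change x ∈ φ '' (ψ ⁻¹' ownedSetZ S (∅ : Finset (Fin 4 × K)))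
    rw [ownedSetZ_empty, himg]
    exact hx
  · intro r r' hne
    exact absurd (Subtype.ext ((hr r).trans (hr r').symm)) hne
  · rw [Finset.mem_singleton.mp hr'] at hq; exact hblocks q hq
  · rw [Finset.mem_singleton.mp hr']; exact hacc

/-- **A MARKED RESOLUTION OF `z^p + F` FROM A v4 PLAN AT ONE ROOT HOST.** See the module docstring.
[cite: BierstoneGrigorievMilmanWlodarczyk2011, Def. 3.1.3; Thm. 1.1 (char. 0 model)] [cite: Hauser2010, §§F–G] -/
theorem exists_isMarkedResolution_atlas_root [IsAlgClosed K] [DecidableEq (AReading K)] (F : MvPolynomial (Fin 4) K) (hF : F ≠ 0)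
    (hclean : Literature.Barriers.ResolutionOfSingularities.HauserPerlega.IsClean p F)
    (plan : AReading K → Finset (Fin 4 × (Fin 4 → K) × Finset (Fin 4)))
    (leaves : AReading K → Finset (Fin 4 × (Fin 4 → K))) (b : Fin 4 → K) (S : Finset (Fin 4)) (s : State K)
    (hs : s = ⟨deletePthPowers p (PointBlowup.translate b F), 0, ∅⟩) (hS : IsPermissibleCentre p S s.F)
    (hblocks : ∀ q : AReading K, Relation.ReflTransGen (fun a e : AReading K => AEdge p plan e a)
      (s, S, (∅ : Finset (Fin 4 × K)), (∅ : Finset (Fin 4))) q → BlockA p plan leaves q)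
    (hacc : Acc (fun q' q : AReading K => AEdge p plan q' q) (s, S, (∅ : Finset (Fin 4 × K)), (∅ : Finset (Fin 4))))
    (hcover : ∀ z : P 4 K, IsClosed ({z} : Set (P 4 K)) → (p : ℕ∞) ≤ idealOrder (hypSheaf p F) z →
      ∀ i ∈ S, (X i.succ - C (b i) : A 4 K) ∈ z.asIdeal) :
    ∃ (X' : Scheme.{0}) (ρ : X' ⟶ P 4 K) (M' : MarkedIdeal X'),
      IsMarkedResolution (⟨hypSheaf p F, [], p⟩ : MarkedIdeal (P 4 K)) ρ M' := by
  classical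
  set M₀ : MarkedIdeal (P 4 K) := ⟨hypSheaf p F, [], p⟩ with hM₀
  have hE₀ : HasSNC M₀.boundary :=
    hasSNC_nil_of_isRegular (Literature.AlgebraicGeometry.Hironaka2017.Lib.AffinePointBlowupLSB.isRegular_Z 4 K)
  obtain ⟨c₀, hdata, -, hall⟩ := root_memberDataAT (p := p) F hF hclean plan leaves b S s hs hS hblocks hacc
  refine exists_isMarkedResolution_of_atlas_node M₀ hE₀ rfl plan leaves ∅ (fun _ => s) (fun x hx => absurd hx (Finset.notMem_empty x))
    (fun x hx => absurd hx (Finset.notMem_empty x)) {c₀} (fun _ => {(s, S, (∅ : Finset (Fin 4 × K)), (∅ : Finset (Fin 4)))})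
    (fun c hc => by rw [Finset.mem_singleton.mp hc]; exact hdata)
    (fun c hc c' hc' hcc => absurd ((Finset.mem_singleton.mp hc).trans (Finset.mem_singleton.mp hc').symm) hcc)
    (fun x hx => absurd hx (Finset.notMem_empty x)) fun z hz hzo => Or.inr ⟨c₀, Finset.mem_singleton_self _, ?_⟩
  exact hall z hz (le_trans (by exact_mod_cast hp.out.one_lt.le) hzo) (hcover z hz hzo)

end RootAT

end Equimultiple

end Summit.ResolutionOfSingularities.ResolutionOfSingularities.Theorems.PIDim4

end
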